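import Summits.AtomisticToContinuum.HydrodynamicLimit.Theorems.JParityClosureEvenStressEnskogEnskogIdentificationFields
import Summits.AtomisticToContinuum.HydrodynamicLimit.Theorems.JParityClosureEvenStressEnskogRung0LocalStatisticsMoments
import HarnessLib

/-!
# Rung-0 local statistics (stub S3b1 `stub_rung0LocalStatistics` of the line
# `preshock-kinetic-slaving`, crux `JParityClosure.EvenStressEnskog`, stmt-AtomisticToContinuum-13079)
# — main file: concentration of the window fields and assembly

For constant profiles `a, θ > 0`, `u` and small reduced diameter `σ` (`SmallDensity uniformProfile σ`,
`exists_smallDensity`), under the rung-0 local Gibbs law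
`G_N = zipConfig_# (posGibbsMeasure a ε_N (N+1) ⊗ ⊗ᵢ N(u, θ id))` and for every flow family:

* (v) `tendsto_measure_windowDeviation`: for `0 < r < 1/2`, every window centre `x` and `ι > 0`,
  `G_N {ι ≤ |ρ_r(x) − 1| + ‖u_r(x) − u‖ + |θ_r(x) − θ|} → 0`.  The five scalar statistics
  `ρ_r − 1`, `(m_r − ρ_r u)ₗ` (`l = 0,1,2`, velocity test `v ↦ vₗ`) and `e_r − ρ_r(‖u‖²/2 + 3θ/2)`
  (test `v ↦ ‖v‖²/2`) tend to `0` in `L²(G_N)` by (iii)/(iv) of the helper file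
  (`tendsto_lintegral_sq_mollDensity_sub_one`, `tendsto_lintegral_sq_velTest`,
  `integral_coord_gaussMeasure`, `integral_half_norm_sq_gaussMeasure`), hence in probability
  (Markov, `tendsto_measure_le_abs_of_lintegral_sq`); the deterministic continuity estimate
  `exists_forall_windowFields_lt` puts the bad event inside the union of the five deviation events.
* `stub_rung0LocalStatistics`: the registered stub, assembled from (i)
  `isProbabilityMeasure_localGibbsLaw`, (ii) `exists_lintegral_velMoments_le`, (iii), (iv), (v).

References: H. Spohn, *Large Scale Dynamics of Interacting Particles* (1991), Part I §2.3
(local equilibrium states and their law of large numbers).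
-/

noncomputable section

open MeasureTheory ProbabilityTheory Filter Set Topology
open scoped ENNReal InnerProductSpace BigOperators

namespace Summit.AtomisticToContinuum.HydrodynamicLimit.Theorems.EvenStressEnskog

open Literature.Analysis.FluidPDE Literature.MathematicalPhysics.KineticTheory

/-! ## (v) Concentration of the window fields -/

/-- **(v) Concentration of `(ρ_r, u_r, θ_r)` at rung 0.**  At small reduced density, for constant
profiles `a, θ > 0`, `u`, every flow family, `0 < r < 1/2`, `x` and `ι > 0`:
`G_N {ι ≤ |ρ_r(x) − 1| + ‖u_r(x) − u‖ + |θ_r(x) − θ|} → 0` as `N → ∞`. [folklore] -/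
theorem tendsto_measure_windowDeviation {σ a θ : ℝ} (hsd : SmallDensity uniformProfile σ)
    (ha : 0 < a) (hθ : 0 < θ) (u : V3)
    (Φ : (N : ℕ) → HardSphereFlow (Torus.geometry (Fin 3)) (hsDiameter σ N) (N + 1))
    {r : ℝ} (hr : 0 < r) (hr2 : r < 1 / 2) (x : T3) {ι : ℝ} (hι : 0 < ι) :
    Tendsto (fun N : ℕ => localGibbsLaw σ (fun _ => a) (fun _ => u) (fun _ => θ) N (Φ N)
      {w | ι ≤ |mollDensity r w x - 1| + ‖KineticEntropyBalance.uC r w x - u‖ +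
        |mollTemperature r w x - θ|}) atTop (𝓝 0) := by
  obtain ⟨κ, hκ, hD⟩ := exists_forall_windowFields_lt u θ ι hι
  have hσ2 : σ ≤ 1 / 2 := hsd.σ_lt_half.le
  -- finite-sum forms of the momentum test and of the momentum coordinates
  have hA : ∀ (N : ℕ) (l : Fin 3) (w : Config (N + 1) (Fin 3) T3),
      (∫ q, coneKernel r q.1 x * q.2 l ∂(empiricalMeasure w)) =
        ((N + 1 : ℕ) : ℝ)⁻¹ * ∑ i, coneKernel r (w i).1 x * (w i).2 l := fun N l w =>
    integral_empiricalMeasure _ _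
  have hml : ∀ (N : ℕ) (l : Fin 3) (w : Config (N + 1) (Fin 3) T3),
      mollMomentum r w x l = ∫ q, coneKernel r q.1 x * q.2 l ∂(empiricalMeasure w) := by
    intro N l w
    rw [hA, mollMomentum, integral_empiricalMeasure_vec]
    simp [Finset.sum_apply, smul_eq_mul]
  -- the `L²` statements: density, momentum coordinates, kinetic energy
  have T0 := tendsto_lintegral_sq_mollDensity_sub_one hsd ha hθ u Φ hr hr2 x
  have T1 : ∀ l : Fin 3, Tendsto (fun N : ℕ => ∫⁻ w, ENNReal.ofReal
      (((∫ q, coneKernel r q.1 x * q.2 l ∂(empiricalMeasure w)) - mollDensity r w x * u l) ^ 2)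
      ∂(localGibbsLaw σ (fun _ => a) (fun _ => u) (fun _ => θ) N (Φ N))) atTop (𝓝 0) := by
    intro l
    have hGl : Continuous fun v : V3 => v l := (EuclideanSpace.proj l).continuous
    have hCl : ∃ C : ℝ, ∀ v : V3, |v l| ≤ C * (1 + ‖v‖ ^ 2) := ⟨1, fun v => by
      have h1 : |v l| ≤ ‖v‖ := by
        rw [← Real.norm_eq_abs]
        exact PiLp.norm_apply_le v l
      nlinarith [sq_nonneg (‖v‖ - 1)]⟩
    have h := tendsto_lintegral_sq_velTest σ ha hθ hσ2 u Φ hr x hGl hCl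
    simp only [integral_coord_gaussMeasure u hθ l] at h
    exact h
  have T2 : Tendsto (fun N : ℕ => ∫⁻ w, ENNReal.ofReal
      (((∫ q, coneKernel r q.1 x * (‖q.2‖ ^ 2 / 2) ∂(empiricalMeasure w)) -
        mollDensity r w x * (‖u‖ ^ 2 / 2 + 3 * θ / 2)) ^ 2)
      ∂(localGibbsLaw σ (fun _ => a) (fun _ => u) (fun _ => θ) N (Φ N))) atTop (𝓝 0) := by
    have hG : Continuous fun v : V3 => ‖v‖ ^ 2 / 2 := by fun_prop
    have hC : ∃ C : ℝ, ∀ v : V3, |‖v‖ ^ 2 / 2| ≤ C * (1 + ‖v‖ ^ 2) := ⟨1, fun v => by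
      rw [abs_of_nonneg (by positivity)]
      nlinarith [sq_nonneg ‖v‖]⟩
    have h := tendsto_lintegral_sq_velTest σ ha hθ hσ2 u Φ hr x hG hC
    simp only [integral_half_norm_sq_gaussMeasure u hθ] at h
    exact h
  -- measurability of the statistics
  have hρm : ∀ N : ℕ, Measurable fun w : Config (N + 1) (Fin 3) T3 => mollDensity r w x :=
    fun N => measurable_mollDensity_comp r measurable_id measurable_const
  have hZ0 : ∀ N : ℕ, Measurable fun w : Config (N + 1) (Fin 3) T3 => mollDensity r w x - 1 :=
    fun N => (hρm N).sub_const 1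
  have hZ1 : ∀ (l : Fin 3) (N : ℕ), Measurable fun w : Config (N + 1) (Fin 3) T3 =>
      (∫ q, coneKernel r q.1 x * q.2 l ∂(empiricalMeasure w)) - mollDensity r w x * u l := by
    intro l N
    have hvl : Measurable fun v : V3 => v l := (EuclideanSpace.proj l).continuous.measurable
    have h1 : Measurable fun w : Config (N + 1) (Fin 3) T3 =>
        ∫ q, coneKernel r q.1 x * q.2 l ∂(empiricalMeasure w) := by
      simp_rw [hA]
      exact measurable_const.mul (Finset.measurable_sum _ fun i _ =>
        (measurable_coneKernel_comp r (measurable_pi_apply i).fst measurable_const).mul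
          (hvl.comp (measurable_pi_apply i).snd))
    exact h1.sub ((hρm N).mul_const _)
  have hZ2 : ∀ N : ℕ, Measurable fun w : Config (N + 1) (Fin 3) T3 =>
      (∫ q, coneKernel r q.1 x * (‖q.2‖ ^ 2 / 2) ∂(empiricalMeasure w)) -
        mollDensity r w x * (‖u‖ ^ 2 / 2 + 3 * θ / 2) := fun N =>
    (measurable_mollKineticEnergy_comp r measurable_id measurable_const).sub ((hρm N).mul_const _)
  -- the five deviation events have vanishing probability
  have E0 := tendsto_measure_le_abs_of_lintegral_sq
    (fun N => localGibbsLaw σ (fun _ => a) (fun _ => u) (fun _ => θ) N (Φ N)) hZ0 T0 hκ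
  have E1 := fun l : Fin 3 => tendsto_measure_le_abs_of_lintegral_sq
    (fun N => localGibbsLaw σ (fun _ => a) (fun _ => u) (fun _ => θ) N (Φ N)) (hZ1 l) (T1 l) hκ
  have E2 := tendsto_measure_le_abs_of_lintegral_sq
    (fun N => localGibbsLaw σ (fun _ => a) (fun _ => u) (fun _ => θ) N (Φ N)) hZ2 T2 hκ
  have hsum := (E0.add (tendsto_finsetSum (Finset.univ : Finset (Fin 3)) fun l _ => E1 l)).add E2
  simp only [add_zero, Finset.sum_const_zero] at hsum
  refine tendsto_of_tendsto_of_tendsto_of_le_of_le tendsto_const_nhds hsum (fun N => zero_le)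
    fun N => ?_
  -- the bad event is inside the union of the five deviation events
  have hincl : {w : Config (N + 1) (Fin 3) T3 | ι ≤ |mollDensity r w x - 1| +
      ‖KineticEntropyBalance.uC r w x - u‖ + |mollTemperature r w x - θ|} ⊆
      ({w | κ ≤ |mollDensity r w x - 1|} ∪
        ⋃ l : Fin 3, {w | κ ≤ |(∫ q, coneKernel r q.1 x * q.2 l ∂(empiricalMeasure w)) -
          mollDensity r w x * u l|}) ∪
      {w | κ ≤ |(∫ q, coneKernel r q.1 x * (‖q.2‖ ^ 2 / 2) ∂(empiricalMeasure w)) -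
          mollDensity r w x * (‖u‖ ^ 2 / 2 + 3 * θ / 2)|} := by
    intro w hw
    by_contra hnot
    simp only [mem_union, mem_iUnion, mem_setOf_eq, not_or, not_exists, not_le] at hnot
    obtain ⟨⟨h0, h1⟩, h2⟩ := hnot
    have key := hD (mollDensity r w x) (mollKineticEnergy r w x) (mollMomentum r w x) h0
      (fun l => by rw [hml]; exact h1 l) h2
    simp only [mem_setOf_eq] at hw
    unfold KineticEntropyBalance.uC mollTemperature at hw
    exact absurd hw (not_le.2 key)
  calc localGibbsLaw σ (fun _ => a) (fun _ => u) (fun _ => θ) N (Φ N)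
        {w | ι ≤ |mollDensity r w x - 1| + ‖KineticEntropyBalance.uC r w x - u‖ +
          |mollTemperature r w x - θ|}
      ≤ localGibbsLaw σ (fun _ => a) (fun _ => u) (fun _ => θ) N (Φ N)
          (({w | κ ≤ |mollDensity r w x - 1|} ∪
            ⋃ l : Fin 3, {w | κ ≤ |(∫ q, coneKernel r q.1 x * q.2 l ∂(empiricalMeasure w)) -
              mollDensity r w x * u l|}) ∪
          {w | κ ≤ |(∫ q, coneKernel r q.1 x * (‖q.2‖ ^ 2 / 2) ∂(empiricalMeasure w)) -
              mollDensity r w x * (‖u‖ ^ 2 / 2 + 3 * θ / 2)|}) := measure_mono hincl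
    _ ≤ localGibbsLaw σ (fun _ => a) (fun _ => u) (fun _ => θ) N (Φ N)
          ({w | κ ≤ |mollDensity r w x - 1|} ∪
            ⋃ l : Fin 3, {w | κ ≤ |(∫ q, coneKernel r q.1 x * q.2 l ∂(empiricalMeasure w)) -
              mollDensity r w x * u l|}) +
        localGibbsLaw σ (fun _ => a) (fun _ => u) (fun _ => θ) N (Φ N)
          {w | κ ≤ |(∫ q, coneKernel r q.1 x * (‖q.2‖ ^ 2 / 2) ∂(empiricalMeasure w)) -
              mollDensity r w x * (‖u‖ ^ 2 / 2 + 3 * θ / 2)|} := measure_union_le _ _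
    _ ≤ localGibbsLaw σ (fun _ => a) (fun _ => u) (fun _ => θ) N (Φ N)
          {w | κ ≤ |mollDensity r w x - 1|} +
        ∑ l : Fin 3, localGibbsLaw σ (fun _ => a) (fun _ => u) (fun _ => θ) N (Φ N)
          {w | κ ≤ |(∫ q, coneKernel r q.1 x * q.2 l ∂(empiricalMeasure w)) -
              mollDensity r w x * u l|} +
        localGibbsLaw σ (fun _ => a) (fun _ => u) (fun _ => θ) N (Φ N)
          {w | κ ≤ |(∫ q, coneKernel r q.1 x * (‖q.2‖ ^ 2 / 2) ∂(empiricalMeasure w)) -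
              mollDensity r w x * (‖u‖ ^ 2 / 2 + 3 * θ / 2)|} :=
        add_le_add ((measure_union_le _ _).trans
          (add_le_add le_rfl (measure_iUnion_fintype_le _ _))) le_rfl

/-! ## The registered stub -/

/-- **S3b1 · Rung-0 local statistics** (registered stub `stub_rung0LocalStatistics` of the line
`preshock-kinetic-slaving`).  For constant profiles `a, θ > 0`, `u`, there is `σ₀ > 0` such that for
`0 < σ < σ₀` and every flow family, under the rung-0 local Gibbs law `G_N`:
(i) every `G_N` is a probability measure; (ii) `E[(N+1)⁻¹Σ‖vᵢ‖²]` and `E[((N+1)⁻¹Σ‖vᵢ‖²)²]` are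
bounded uniformly in `N`; and for `0 < r < 1/2` and every window centre `x`: (iii)
`E[(ρ_r(x) − 1)²] → 0`; (iv) `E[(∫ b_r G dμ_w − ρ_r(x) ∫ G dN(u, θ id))²] → 0` for every continuous
velocity test `G` of quadratic growth; (v) `G_N {ι ≤ |ρ_r − 1| + ‖u_r − u‖ + |θ_r − θ|} → 0` for every
`ι > 0` (Spohn 1991, Part I §2.3: local equilibrium law of large numbers, here at a single point and
for the uniform profile). [folklore] -/
theorem stub_rung0LocalStatistics :
    ∀ (a θ : ℝ) (u : V3), 0 < a → 0 < θ → ∃ σ₀ : ℝ, 0 < σ₀ ∧ ∀ σ : ℝ, 0 < σ → σ < σ₀ →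
    ∀ Φ : (N : ℕ) → HardSphereFlow (Torus.geometry (Fin 3)) (hsDiameter σ N) (N + 1),
    (∀ N, IsProbabilityMeasure (localGibbsLaw σ (fun _ => a) (fun _ => u) (fun _ => θ) N (Φ N))) ∧
    (∃ K : ℝ, ∀ N : ℕ,
      ∫⁻ w, ENNReal.ofReal (((N + 1 : ℕ) : ℝ)⁻¹ * ∑ i, ‖(w i).2‖ ^ 2)
          ∂(localGibbsLaw σ (fun _ => a) (fun _ => u) (fun _ => θ) N (Φ N)) ≤ ENNReal.ofReal K ∧
      ∫⁻ w, ENNReal.ofReal ((((N + 1 : ℕ) : ℝ)⁻¹ * ∑ i, ‖(w i).2‖ ^ 2) ^ 2)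
          ∂(localGibbsLaw σ (fun _ => a) (fun _ => u) (fun _ => θ) N (Φ N)) ≤ ENNReal.ofReal K) ∧
    ∀ r : ℝ, 0 < r → r < 1 / 2 → ∀ x : T3,
      Tendsto (fun N : ℕ => ∫⁻ w, ENNReal.ofReal ((mollDensity r w x - 1) ^ 2)
        ∂(localGibbsLaw σ (fun _ => a) (fun _ => u) (fun _ => θ) N (Φ N))) atTop (𝓝 0) ∧
      (∀ G : V3 → ℝ, Continuous G → (∃ C : ℝ, ∀ v, |G v| ≤ C * (1 + ‖v‖ ^ 2)) →
        Tendsto (fun N : ℕ => ∫⁻ w, ENNReal.ofReal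
            (((∫ q, coneKernel r q.1 x * G q.2 ∂(empiricalMeasure w)) -
              mollDensity r w x * ∫ v, G v ∂(gaussMeasure u θ)) ^ 2)
          ∂(localGibbsLaw σ (fun _ => a) (fun _ => u) (fun _ => θ) N (Φ N))) atTop (𝓝 0)) ∧
      ∀ ι : ℝ, 0 < ι →
        Tendsto (fun N : ℕ => localGibbsLaw σ (fun _ => a) (fun _ => u) (fun _ => θ) N (Φ N)
          {w | ι ≤ |mollDensity r w x - 1| + ‖KineticEntropyBalance.uC r w x - u‖ +
            |mollTemperature r w x - θ|}) atTop (𝓝 0) := by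
  intro a θ u ha hθ
  obtain ⟨σ₀, hσ₀, hsmall⟩ := exists_smallDensity uniformProfile one_pos
  refine ⟨σ₀, hσ₀, fun σ hσ hσlt Φ => ?_⟩
  have hsd : SmallDensity uniformProfile σ := (hsmall σ hσ hσlt).1
  have hσ2 : σ ≤ 1 / 2 := hsd.σ_lt_half.le
  refine ⟨fun N => isProbabilityMeasure_localGibbsLaw continuous_const continuous_const
    continuous_const (fun _ => ha) (fun _ => hθ) hσ2 N (Φ N),
    exists_lintegral_velMoments_le σ ha hθ hσ2 u Φ, fun r hr hr2 x => ⟨?_, ?_, ?_⟩⟩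
  · exact tendsto_lintegral_sq_mollDensity_sub_one hsd ha hθ u Φ hr hr2 x
  · exact fun G hG hC => tendsto_lintegral_sq_velTest σ ha hθ hσ2 u Φ hr x hG hC
  · exact fun ι hι => tendsto_measure_windowDeviation hsd ha hθ u Φ hr hr2 x hι

end Summit.AtomisticToContinuum.HydrodynamicLimit.Theorems.EvenStressEnskog

end
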